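/-
Copyright (c) 2026 the pub-hodgecm-mathlib formalisation cell (harness21).  Prover seat hodgecm-mathlib-F0P3-p01 (g31), «(D-RAM) FOUR-FRAME» road of crux H413, line LH4, MS ROAD A,
STAGE B ∕ B56₂: «ON THE GLUE FOOT AT A GENERAL CORNER: orbit decomposition and the glue summand of Σ w» — predicate-free, corner-general twin of ★ F3a §1 ∕ F3b (LH4-p08 (g2)).  2026-09-04.
-/
import Summits.HodgeConjecture.HodgeConjecture.Theorems.F0P3cDyRamDiagonalGluedFootClasses           -- ★ (LH4-p08 (g2)) F3a: `ncard_glue_representatives_eq`, `glue_representatives_eq_empty` (corner-free)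
import Summits.HodgeConjecture.HodgeConjecture.Theorems.F0P3cDyRamDiagonalGluedBoxCountCorner        -- ★ p856228 (this seat): corner orbits ∕ κ-invariance ∕ x-representative ∕ (R)-κ; brings ★ IndexCorner, ★ IndexFullCorner, ★ (iv-a), ★ (iv-c)
import Summits.HodgeConjecture.HodgeConjecture.Theorems.F0P3cDyRamDiagonalGluedStabilityCorner       -- ★ p856176 (this seat): corner stability congruences
import Summits.HodgeConjecture.HodgeConjecture.Theorems.F0P3cDyRamDiagonalStratumTools              -- ★ (LH4-p13 (g2)): `finsum_mem_eq_ncard_mul`, `stabiliserWeight_mapGL_diagGLUnits`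
import Mathlib.Data.Set.Card.Arithmetic
import HarnessLib

/-!
# Crux `H413`, MS ROAD A, STAGE B ∕ B56₂: the glue foot at a general corner `2ρ + 2t + e` — the stable (R)-lattices are a disjoint union of unit-torus orbits over the glue classes;
# the glue summand of `Σ w`

Cell `hodgecm-mathlib` (D-0151), FLOOR 0, crux item H413 = `stmt-HodgeConjecture-24833`; lane `--supports stmt-HodgeConjecture-24833 --as helper` (count-neutral).  THEOREMS ONLY
(no `def`, no instance, no notation, no `sorry`).  Twin of LH4-p08 (g2)'s B56 FILES F3a §1 ∕ F3b (`F0P3cDyRamDiagonalGluedFootClasses`, `…GluedFootContribution`; corner `2ρ + 2t`,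
DUALISABLE) for the frame `V(x,ζ,y″) = (1 0 0; x ϖ^ρ 0; xζ+y″ ϖ^ρζ ϖ^{2ρ+2t+e})` with DUALISABLE ↦ the raw criterion (R) `∃ f = σf, |ζσy″ − σx·f| ≤ |ϖ|^{ρ+2t}` (no trace bound, no
`t ≥ 1`).  On the glue foot `|β−1| = |ϖ|^{m+2t}`, `|α−1| = |β−α| = |ϖ|^m` with `ρ + e ≤ m < 2ρ + e`: (§1) `T`-stability ⟺ `|κ + g₀| ≤ |ϖ|^{2ρ+2t+e−m}` (`κ = y″∕(xζ)`, `g₀ = (β−1)∕(α−1)`;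
★ p856176); (§2) the stable (R)-family is `⨆_{g ∈ R, |g + g₀| ≤ |ϖ|^{2ρ+2t+e−m}} 𝒯·latt V(1,1,g)` over ★ (iv-c)'s representatives (the class of `κ` mod `𝔭^{ρ+2t}` is an orbit
invariant at every corner, ★ p856228), so `Σ w = #glue classes × |orbit| × weight` with ★ F3a `ncard_glue_representatives_eq`, ★ p856198's orbit size and ★ p856076's weight;
(§3) the TYPE-2 letters (`e = 1`, corner `2ρ+1+2t`, glue regime `ρ+1 ≤ m < 2ρ+1`): **`Σ w = q^{ρ + t + ⌈m∕2⌉ − 1 + ρ % 2}`** if some fixed `f₀` has `|f₀ + g₀| ≤ |ϖ|^{2ρ+2t+1−m}`,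
`0` otherwise — for ODD ρ this is the B10₂ skeleton 08e5e6e2 glue value `q^{2ρ+1+t−⌈(2ρ+1−m)∕2⌉} = q^{ρ+t+⌈m∕2⌉}`, for EVEN ρ it is that value divided by `q = n₂` (dealer WORD #21
re-key: the type-2 glue contribution is `n₂ · Σ w`).
HONEST LABEL.  Count-neutral (`--supports`); the census laws (MS) stay PROVER TARGETS until the Stage B ∕ B9 assemblies land (type-2 heads under re-key); `HC_CM` is proved only
modulo the 7 printed citations (2 remaining named inputs: hLiu418 = `stmt-HodgeConjecture-24832`, h413 = `stmt-HodgeConjecture-24833`) until rung 0 closes.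

## References
* [Kottwitz1986BaseChangeUnits] R. E. Kottwitz, *Base change for unit elements of Hecke algebras*, Compositio Math. 60 (1986), §1 pp. 240–241 (fixed-lattice counting by torus orbits).
* [Rogawski1990] J. D. Rogawski, *Automorphic Representations of Unitary Groups in Three Variables*, Ann. of Math. Stud. 123 (1990), §4.9 Prop. 4.9.1 (a) p. 55.
* [Serre1979] J.-P. Serre, *Local Fields*, GTM 67 (1979), Ch. IV §2 Prop. 6.
-/

set_option autoImplicit false

noncomputable section

namespace Summit.HodgeConjecture.HodgeConjecture.Cruxes.H413.F0P3cDyRamDiagonalGluedFootContributionCorner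

open Matrix WithZero
open Literature.NumberTheory.Automorphic Literature.NumberTheory.Automorphic.HermitianLattice
open Literature.NumberTheory.Automorphic.UnitaryLatticeTree
open Summit.HodgeConjecture.HodgeConjecture.Cruxes.H413.F0P3cDyRamDiagonalTorusDefs
open Summit.HodgeConjecture.HodgeConjecture.Cruxes.H413.F0P3cDyRamDiagonalGluedTorusOrbits (exists_gl_coe_eq_glued exists_glued_of_mem_orbit)
open Summit.HodgeConjecture.HodgeConjecture.Cruxes.H413.F0P3cDyRamDiagonalGluedStabiliserIndex (ne_zero_and_v_lt_one_of_v_eq_exp)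
open Summit.HodgeConjecture.HodgeConjecture.Cruxes.H413.F0P3cDyRamDiagonalGluedStabiliserIndexCorner (relIndex_fixedUnitStabilizer_latt_glued_corner_eq_of_lineariser
  relIndex_fixedUnitStabilizer_latt_glued_corner_eq)
open Summit.HodgeConjecture.HodgeConjecture.Cruxes.H413.F0P3cDyRamDiagonalGluedStabiliserIndexFullCorner (ncard_unitTorus_orbit_latt_glued_corner_eq)
open Summit.HodgeConjecture.HodgeConjecture.Cruxes.H413.F0P3cDyRamDiagonalGluedBoxCountCorner
open Summit.HodgeConjecture.HodgeConjecture.Cruxes.H413.F0P3cDyRamDiagonalGluedStabilityCorner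
open Summit.HodgeConjecture.HodgeConjecture.Cruxes.H413.F0P3cDyRamDiagonalGluedFootClasses (ncard_glue_representatives_eq glue_representatives_eq_empty)
open Summit.HodgeConjecture.HodgeConjecture.Cruxes.H413.F0P3cDyRamDiagonalGluedClassRepresentatives (exists_fixed_class_representatives)
open Summit.HodgeConjecture.HodgeConjecture.Cruxes.H413.F0P3cDyRamDiagonalStratumTools (finsum_mem_eq_ncard_mul stabiliserWeight_mapGL_diagGLUnits)
open scoped Valued WithZero Matrix MatrixGroups

variable {K : Type*} [Field K] [Valued K ℤᵐ⁰]

/-! ## §1 Stability on the glue foot at a general corner, in `κ`-currency -/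

/-- **STABILITY ON THE GLUE FOOT, general corner** (`|β−1| = |ϖ|^{m+2t}`, `|α−1| = |β−α| = |ϖ|^m`, `ρ + e ≤ m ≤ 2ρ + 2t + e`): a glued `V(x,ζ,y″)` at corner `2ρ+2t+e` is `T`-stable iff
`|y″∕(xζ) + (β−1)∕(α−1)| ≤ |ϖ|^{2ρ+2t+e−m}` (★ p856176's three congruences; the third factors as `|α−1|·|xζ|·|κ + g₀|`). [cite: Kottwitz1986BaseChangeUnits, §1 pp. 240–241] -/
theorem mapGL_latt_glued_corner_eq_iff_kappa {ϖ : K} (hϖ : Valued.v ϖ = exp (-1 : ℤ)) {α β : K} (hα : Valued.v α = 1) (hβ : Valued.v β = 1)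
    (T : GL (Fin 3) K) (hT : (T : Matrix (Fin 3) (Fin 3) K) = Matrix.diagonal ![α, β, 1]) {m t : ℕ}
    (h₁ : Valued.v (β - 1) = Valued.v ϖ ^ (m + 2 * t)) (h₂ : Valued.v (α - 1) = Valued.v ϖ ^ m) (h₃ : Valued.v (β - α) = Valued.v ϖ ^ m)
    {ρ e : ℕ} (hρm : ρ + e ≤ m) (hm : m ≤ 2 * ρ + 2 * t + e) {x ζ y'' : K} (hx : Valued.v x = 1) (hζ : Valued.v ζ = 1) (V : GL (Fin 3) K)
    (hV : (V : Matrix (Fin 3) (Fin 3) K) = !![1, 0, 0; x, ϖ ^ ρ, 0; x * ζ + y'', ϖ ^ ρ * ζ, ϖ ^ (2 * ρ + 2 * t + e)]) :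
    mapGL T (latt (V : Matrix (Fin 3) (Fin 3) K)) = latt (V : Matrix (Fin 3) (Fin 3) K) ↔
      Valued.v (y'' / (x * ζ) + (β - 1) / (α - 1)) ≤ Valued.v ϖ ^ (2 * ρ + 2 * t + e - m) := by
  obtain ⟨hϖ0, hϖ1⟩ := ne_zero_and_v_lt_one_of_v_eq_exp hϖ
  have hvϖ : 0 < Valued.v ϖ := (Valuation.pos_iff _).2 hϖ0
  have hvϖ0 : Valued.v ϖ ≠ 0 := hvϖ.ne'
  have hanti : ∀ {a b : ℕ}, a ≤ b → Valued.v ϖ ^ b ≤ Valued.v ϖ ^ a := fun h => pow_le_pow_right_of_le_one' hϖ1.le h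
  have hα1 : α - 1 ≠ 0 := fun h => by rw [h, map_zero] at h₂; exact pow_ne_zero m hvϖ0 h₂.symm
  have hx0 : x ≠ 0 := (Valuation.ne_zero_iff _).1 (by rw [hx]; exact one_ne_zero)
  have hζ0 : ζ ≠ 0 := (Valuation.ne_zero_iff _).1 (by rw [hζ]; exact one_ne_zero)
  rw [mapGL_latt_hnf_glued_corner_eq_iff hϖ0 hα hβ T hT ρ (2 * t) e x ζ y'' V hV]
  have c1 : Valued.v ((β - α) * x) ≤ Valued.v ϖ ^ ρ := by rw [map_mul, hx, mul_one, h₃]; exact hanti (by omega)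
  have c2 : Valued.v ((β - 1) * ζ) ≤ Valued.v ϖ ^ (ρ + 2 * t + e) := by rw [map_mul, hζ, mul_one, h₁]; exact hanti (by omega)
  have hfac : (β - 1) * x * ζ + (α - 1) * y'' = (α - 1) * (x * ζ) * (y'' / (x * ζ) + (β - 1) / (α - 1)) := by
    field_simp
    ring
  have hsplit : Valued.v ϖ ^ (2 * ρ + 2 * t + e) = Valued.v ϖ ^ m * Valued.v ϖ ^ (2 * ρ + 2 * t + e - m) := by
    rw [← pow_add, Nat.add_sub_cancel' hm]
  simp only [c1, c2, true_and]
  rw [hfac, map_mul, map_mul, map_mul, hx, hζ, mul_one, mul_one, h₂, hsplit]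
  exact mul_le_mul_iff_right₀ (pow_pos hvϖ m)

/-! ## §2 The sum over the stable (R)-family on the foot, for any representative system, general corner -/

/-- **THE STABLE (R)-FAMILY ON THE FOOT IS A DISJOINT UNION OF UNIT-TORUS ORBITS OVER THE GLUE CLASSES**, general corner, so its weighted count is `#R′ · |𝒯-orbit| · weight`:
for `T = diag(α, β, 1)` on the glue foot (`|β−1| = |ϖ|^{m+2t}`, `|α−1| = |β−α| = |ϖ|^m`, `ρ + e ≤ m < 2ρ + e`, `ρ ≥ 1`), any irredundant complete system `R` of the fixed elements of
valuation `|ϖ|^{2t}` mod `𝔭^{ρ+2t}`: `∑ᶠ w = #{g ∈ R : |g + (β−1)∕(α−1)| ≤ |ϖ|^{2ρ+2t+e−m}} · ((q−1)q^{ρ+2t+e−1})((q−1)q^{2ρ+e−1}) · (((q−1)q^{(ρ+2t+e+1)∕2−1})((q−1)q^{(2ρ+e+1)∕2−1}))⁻¹`.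
[cite: Kottwitz1986BaseChangeUnits, §1 pp. 240–241] [cite: Rogawski1990, §4.9 Prop. 4.9.1 (a) p. 55] -/
theorem finsum_stabiliserWeight_gluedR_foot_corner_eq_ncard_mul {σ : K →+* K} (hσ : ∀ a, σ (σ a) = a) (hvσ : ∀ a, Valued.v (σ a) = Valued.v a)
    (hfix : ∀ x : K, σ x = x → x ≠ 0 → ∃ n : ℤ, Valued.v x = exp (2 * n)) {ϖ : K} (hϖ : Valued.v ϖ = exp (-1 : ℤ))
    {d : ℕ} (hd : Valued.v (ϖ - σ ϖ) = Valued.v ϖ ^ d) [Finite 𝓀[K]]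
    {α β : K} (hα : Valued.v α = 1) (hβ : Valued.v β = 1) (T : GL (Fin 3) K) (hT : (T : Matrix (Fin 3) (Fin 3) K) = Matrix.diagonal ![α, β, 1])
    (ρ t e m : ℕ) (hρ : 1 ≤ ρ) (h₁ : Valued.v (β - 1) = Valued.v ϖ ^ (m + 2 * t)) (h₂ : Valued.v (α - 1) = Valued.v ϖ ^ m)
    (h₃ : Valued.v (β - α) = Valued.v ϖ ^ m) (hρm : ρ + e ≤ m) (hm : m < 2 * ρ + e) {R : Set K} (hRfin : R.Finite)
    (hR1 : ∀ g ∈ R, σ g = g ∧ Valued.v g = Valued.v ϖ ^ (2 * t))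
    (hR2 : ∀ f : K, σ f = f → Valued.v f = Valued.v ϖ ^ (2 * t) → ∃ g ∈ R, Valued.v (f - g) ≤ Valued.v ϖ ^ (ρ + 2 * t))
    (hR3 : ∀ g ∈ R, ∀ g' ∈ R, Valued.v (g - g') ≤ Valued.v ϖ ^ (ρ + 2 * t) → g = g') :
    ∑ᶠ M ∈ {M : Submodule 𝒪[K] (Fin 3 → K) | ∃ x ζ y'' : K, Valued.v x = 1 ∧ Valued.v ζ = 1 ∧ Valued.v y'' = Valued.v ϖ ^ (2 * t) ∧
        M = latt (!![1, 0, 0; x, ϖ ^ ρ, 0; x * ζ + y'', ϖ ^ ρ * ζ, ϖ ^ (2 * ρ + 2 * t + e)] : Matrix (Fin 3) (Fin 3) K) ∧ mapGL T M = M ∧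
        ∃ f : K, σ f = f ∧ Valued.v (ζ * σ y'' - σ x * f) ≤ Valued.v ϖ ^ (ρ + 2 * t)},
        stabiliserWeight σ M =
      ({g ∈ R | Valued.v (g + (β - 1) / (α - 1)) ≤ Valued.v ϖ ^ (2 * ρ + 2 * t + e - m)}.ncard : ℚ) *
        ((((Nat.card 𝓀[K] - 1) * Nat.card 𝓀[K] ^ (ρ + 2 * t + e - 1)) * ((Nat.card 𝓀[K] - 1) * Nat.card 𝓀[K] ^ (2 * ρ + e - 1)) : ℕ) : ℚ) *
        ((((Nat.card 𝓀[K] - 1) * Nat.card 𝓀[K] ^ ((ρ + 2 * t + e + 1) / 2 - 1)) * ((Nat.card 𝓀[K] - 1) * Nat.card 𝓀[K] ^ ((2 * ρ + e + 1) / 2 - 1)) : ℕ) : ℚ)⁻¹ := by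
  classical
  obtain ⟨hϖ0, hϖ1⟩ := ne_zero_and_v_lt_one_of_v_eq_exp hϖ
  have hpρ : ϖ ^ ρ ≠ 0 := pow_ne_zero ρ hϖ0
  have hpr : ϖ ^ (2 * ρ + 2 * t + e) ≠ 0 := pow_ne_zero _ hϖ0
  have hm' : m ≤ 2 * ρ + 2 * t + e := by omega
  have hanti : ∀ {a b : ℕ}, a ≤ b → Valued.v ϖ ^ b ≤ Valued.v ϖ ^ a := fun h => pow_le_pow_right_of_le_one' hϖ1.le h
  -- reference lattices `V₀(g) = V(1, 1, g)` and their orbits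
  choose V₀ hV₀ using fun g : K => exists_gl_coe_eq_glued (1 : K) 1 g hpρ hpr
  set Orb : K → Set (Submodule 𝒪[K] (Fin 3 → K)) := fun g => {M | ∃ u ∈ unitTorus K 3, M = mapGL (diagGLUnits u) (latt (V₀ g : Matrix (Fin 3) (Fin 3) K))}
    with hOrb
  set R' : Set K := {g ∈ R | Valued.v (g + (β - 1) / (α - 1)) ≤ Valued.v ϖ ^ (2 * ρ + 2 * t + e - m)} with hR'
  have hlt : Valued.v ϖ ^ (ρ + 2 * t) < Valued.v ϖ ^ (2 * t) := by
    rw [pow_add, mul_comm]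
    exact mul_lt_of_lt_one_right (pow_pos ((Valuation.pos_iff _).2 hϖ0) _) (pow_lt_one₀ zero_le hϖ1 (by omega))
  have hen : Valued.v ϖ ^ (ρ + 2 * t) ≤ Valued.v ϖ ^ (2 * ρ + 2 * t + e - m) := hanti (by omega)
  have h11 : Valued.v (1 : K) = 1 := map_one _
  -- §2a: the set identity
  have hset : {M : Submodule 𝒪[K] (Fin 3 → K) | ∃ x ζ y'' : K, Valued.v x = 1 ∧ Valued.v ζ = 1 ∧ Valued.v y'' = Valued.v ϖ ^ (2 * t) ∧
        M = latt (!![1, 0, 0; x, ϖ ^ ρ, 0; x * ζ + y'', ϖ ^ ρ * ζ, ϖ ^ (2 * ρ + 2 * t + e)] : Matrix (Fin 3) (Fin 3) K) ∧ mapGL T M = M ∧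
        ∃ f : K, σ f = f ∧ Valued.v (ζ * σ y'' - σ x * f) ≤ Valued.v ϖ ^ (ρ + 2 * t)} = ⋃ g ∈ R', Orb g := by
    ext M
    simp only [Set.mem_setOf_eq, Set.mem_iUnion, hOrb, hR', exists_prop]
    constructor
    · rintro ⟨x, ζ, y'', hx, hζ, hy'', rfl, hstab, hR⟩
      obtain ⟨V, hV⟩ := exists_gl_coe_eq_glued x ζ y'' hpρ hpr
      rw [← hV] at hstab
      have hκ := (mapGL_latt_glued_corner_eq_iff_kappa hϖ hα hβ T hT h₁ h₂ h₃ hρm hm' hx hζ V hV).1 hstab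
      obtain ⟨f, hσf, hκf⟩ := (criterionR_iff_exists_fixed_kappa hσ hvσ hx hζ y'' _).1 hR
      have hvκ : Valued.v (y'' / (x * ζ)) = Valued.v ϖ ^ (2 * t) := by rw [map_div₀, map_mul, hx, hζ, mul_one, div_one, hy'']
      have hvf : Valued.v f = Valued.v ϖ ^ (2 * t) := by
        have h := Valuation.map_sub_eq_of_lt_left Valued.v (hvκ ▸ hκf.trans_lt hlt : Valued.v (y'' / (x * ζ) - f) < Valued.v (y'' / (x * ζ)))
        rw [← hvκ, ← h, sub_sub_cancel]
      obtain ⟨g, hg, hfg⟩ := hR2 f hσf hvf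
      have hκg : Valued.v (y'' / (x * ζ) - g) ≤ Valued.v ϖ ^ (ρ + 2 * t) := by
        rw [show y'' / (x * ζ) - g = (y'' / (x * ζ) - f) + (f - g) by ring]
        exact Valuation.map_add_le _ hκf hfg
      obtain ⟨u, hu, hM⟩ := exists_mem_unitTorus_latt_glued_corner_eq_mapGL hϖ0 ρ (2 * t) hx hζ hy'' (hR1 g hg).2 hκg hpr (V₀ g) (hV₀ g)
      refine ⟨g, ⟨hg, ?_⟩, u, hu, hM⟩
      rw [show g + (β - 1) / (α - 1) = (y'' / (x * ζ) + (β - 1) / (α - 1)) - (y'' / (x * ζ) - g) by ring]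
      exact Valuation.map_sub_le _ hκ (hκg.trans hen)
    · rintro ⟨g, ⟨hg, hge⟩, u, hu, rfl⟩
      obtain ⟨x', ζ', y₁, hx', hζ', hy₁, hκ, hM⟩ := exists_glued_of_mem_orbit u hu g (ϖ ^ ρ) (ϖ ^ (2 * ρ + 2 * t + e)) (V₀ g) (hV₀ g)
      have hy₁' : Valued.v y₁ = Valued.v ϖ ^ (2 * t) := by rw [hy₁, (hR1 g hg).2]
      obtain ⟨V, hV⟩ := exists_gl_coe_eq_glued x' ζ' y₁ hpρ hpr
      refine ⟨x', ζ', y₁, hx', hζ', hy₁', hM, ?_, ?_⟩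
      · rw [hM, ← hV]
        exact (mapGL_latt_glued_corner_eq_iff_kappa hϖ hα hβ T hT h₁ h₂ h₃ hρm hm' hx' hζ' V hV).2 (by rw [hκ]; exact hge)
      · exact (criterionR_iff_exists_fixed_kappa hσ hvσ hx' hζ' y₁ _).2 ⟨g, (hR1 g hg).1, by rw [hκ, sub_self, map_zero]; exact zero_le⟩
  -- §2b: pairwise disjoint
  have hdisj : R'.PairwiseDisjoint Orb := by
    intro g hg g' hg' hne
    rw [Function.onFun, Set.disjoint_left]
    intro M hM hM'
    apply hne
    simp only [hOrb, Set.mem_setOf_eq] at hM hM'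
    obtain ⟨u, hu, rfl⟩ := hM
    obtain ⟨u', hu', hMM⟩ := hM'
    obtain ⟨x, ζ, y, hx, hζ, hy, hκ, h1⟩ := exists_glued_of_mem_orbit u hu g (ϖ ^ ρ) (ϖ ^ (2 * ρ + 2 * t + e)) (V₀ g) (hV₀ g)
    obtain ⟨x', ζ', y', hx', hζ', -, hκ', h2⟩ := exists_glued_of_mem_orbit u' hu' g' (ϖ ^ ρ) (ϖ ^ (2 * ρ + 2 * t + e)) (V₀ g') (hV₀ g')
    have hyv : Valued.v y = Valued.v ϖ ^ (2 * t) := by rw [hy, (hR1 g hg.1).2]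
    have hv := v_kappa_sub_le_of_latt_glued_corner_eq hϖ0 hϖ1.le ρ (2 * t) e hx hζ hyv hx' hζ' (h1.symm.trans (hMM.trans h2))
    rw [hκ, hκ'] at hv
    exact hR3 g hg.1 g' hg'.1 hv
  -- §2c: orbit sizes and the (constant) weight
  have hN : ∀ g ∈ R', (Orb g).ncard = ((Nat.card 𝓀[K] - 1) * Nat.card 𝓀[K] ^ (ρ + 2 * t + e - 1)) * ((Nat.card 𝓀[K] - 1) * Nat.card 𝓀[K] ^ (2 * ρ + e - 1)) :=
    fun g hg => ncard_unitTorus_orbit_latt_glued_corner_eq hϖ hρ (2 * t) e h11 h11 (by rw [(hR1 g hg.1).2]) (V₀ g) (by rw [hV₀ g])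
  have hq : 1 < Nat.card 𝓀[K] := Finite.one_lt_card
  have hN0 : ((Nat.card 𝓀[K] - 1) * Nat.card 𝓀[K] ^ (ρ + 2 * t + e - 1)) * ((Nat.card 𝓀[K] - 1) * Nat.card 𝓀[K] ^ (2 * ρ + e - 1)) ≠ 0 :=
    mul_ne_zero (mul_ne_zero (by omega) (pow_ne_zero _ (by omega))) (mul_ne_zero (by omega) (pow_ne_zero _ (by omega)))
  have hfinOrb : ∀ g ∈ R', (Orb g).Finite := fun g hg => Set.finite_of_ncard_ne_zero (by rw [hN g hg]; exact hN0)
  have hw : ∀ g ∈ R', ∀ M ∈ Orb g, stabiliserWeight σ M =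
      ((((Nat.card 𝓀[K] - 1) * Nat.card 𝓀[K] ^ ((ρ + 2 * t + e + 1) / 2 - 1)) * ((Nat.card 𝓀[K] - 1) * Nat.card 𝓀[K] ^ ((2 * ρ + e + 1) / 2 - 1)) : ℕ) : ℚ)⁻¹ := by
    rintro g hg M ⟨u, -, rfl⟩
    rw [stabiliserWeight_mapGL_diagGLUnits]
    unfold stabiliserWeight
    rw [relIndex_fixedUnitStabilizer_latt_glued_corner_eq hσ hvσ hfix hϖ hd hρ (2 * t) e h11 h11 (hR1 g hg.1).2 (V₀ g) (hV₀ g) (hR1 g hg.1).1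
      (by rw [map_one, (hR1 g hg.1).1, one_mul, sub_self, map_zero]; exact zero_le)]
  have hR'fin : R'.Finite := hRfin.subset (Set.sep_subset _ _)
  rw [hset, finsum_mem_biUnion hdisj hR'fin hfinOrb,
    finsum_mem_congr rfl (fun g hg => finsum_mem_eq_ncard_mul (hfinOrb g hg) _ _ (hw g hg)),
    finsum_mem_congr rfl (fun g hg => by rw [hN g hg]), finsum_mem_eq_ncard_mul hR'fin _ _ (fun g _ => rfl)]
  ring

/-! ## §3 HEADS — the glue summand of `Σ w`, type 2 -/

/-- **TYPE 2 — THE GLUE SUMMAND `Σ w = q^{ρ + t + ⌈m∕2⌉ − 1 + ρ % 2}`** on the glued stratum `G₁(2ρ+1, 2t)` at its glue foot (`|β−1| = |ϖ|^{m+2t}`, `|α−1| = |β−α| = |ϖ|^m`, `ρ+1 ≤ m < 2ρ+1`,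
`ρ ≥ 1`), IF some fixed `f₀` has `|f₀ + (β−1)∕(α−1)| ≤ |ϖ|^{2ρ+2t+1−m}`: `q^{⌈(ρ+2t)∕2⌉−⌈j∕2⌉}` glue classes (★ F3a, `j = 2ρ+2t+1−m`) × `((q−1)q^{ρ+2t})((q−1)q^{2ρ})` (★ p856198) ×
the ★ p856076 weight.  For EVEN ρ the B10₂ skeleton glue value `q^{ρ+t+⌈m∕2⌉}` is `q` times this (`n₂ = q`); for ODD ρ they agree.
[cite: Kottwitz1986BaseChangeUnits, §1 pp. 240–241] [cite: Rogawski1990, §4.9 Prop. 4.9.1 (a) p. 55] -/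
theorem finsum_stabiliserWeight_gluedR_foot_typeTwo_eq {σ : K →+* K} (hσ : ∀ a, σ (σ a) = a) (hvσ : ∀ a, Valued.v (σ a) = Valued.v a)
    (hfix : ∀ x : K, σ x = x → x ≠ 0 → ∃ n : ℤ, Valued.v x = exp (2 * n)) {ϖ : K} (hϖ : Valued.v ϖ = exp (-1 : ℤ))
    {d : ℕ} (hd : Valued.v (ϖ - σ ϖ) = Valued.v ϖ ^ d) [Finite 𝓀[K]]
    {α β : K} (hα : Valued.v α = 1) (hβ : Valued.v β = 1) (T : GL (Fin 3) K) (hT : (T : Matrix (Fin 3) (Fin 3) K) = Matrix.diagonal ![α, β, 1])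
    (ρ t m : ℕ) (hρ : 1 ≤ ρ) (h₁ : Valued.v (β - 1) = Valued.v ϖ ^ (m + 2 * t)) (h₂ : Valued.v (α - 1) = Valued.v ϖ ^ m)
    (h₃ : Valued.v (β - α) = Valued.v ϖ ^ m) (hρm : ρ + 1 ≤ m) (hm : m < 2 * ρ + 1)
    {f₀ : K} (hσf₀ : σ f₀ = f₀) (hf₀ : Valued.v (f₀ + (β - 1) / (α - 1)) ≤ Valued.v ϖ ^ (2 * ρ + 2 * t + 1 - m)) :
    ∑ᶠ M ∈ {M : Submodule 𝒪[K] (Fin 3 → K) | ∃ x ζ y'' : K, Valued.v x = 1 ∧ Valued.v ζ = 1 ∧ Valued.v y'' = Valued.v ϖ ^ (2 * t) ∧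
        M = latt (!![1, 0, 0; x, ϖ ^ ρ, 0; x * ζ + y'', ϖ ^ ρ * ζ, ϖ ^ (2 * ρ + 2 * t + 1)] : Matrix (Fin 3) (Fin 3) K) ∧ mapGL T M = M ∧
        ∃ f : K, σ f = f ∧ Valued.v (ζ * σ y'' - σ x * f) ≤ Valued.v ϖ ^ (ρ + 2 * t)},
        stabiliserWeight σ M = (Nat.card 𝓀[K] : ℚ) ^ (ρ + t + (m + 1) / 2 - 1 + ρ % 2) := by
  obtain ⟨R, hRfin, -, hR1, hR2, hR3⟩ := exists_fixed_class_representatives hσ hvσ hfix hϖ hd ρ t hρ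
  have hvϖ0 : Valued.v ϖ ≠ 0 := by rw [hϖ]; exact exp_ne_zero
  have hg₀ : Valued.v ((β - 1) / (α - 1)) = Valued.v ϖ ^ (2 * t) := by
    rw [map_div₀, h₁, h₂, pow_add, mul_div_cancel_left₀ _ (pow_ne_zero m hvϖ0)]
  rw [finsum_stabiliserWeight_gluedR_foot_corner_eq_ncard_mul hσ hvσ hfix hϖ hd hα hβ T hT ρ t 1 m hρ h₁ h₂ h₃ hρm hm hRfin hR1 hR2 hR3,
    ncard_glue_representatives_eq hσ hvσ hfix hϖ hd (by omega) (by omega) hRfin hR1 hR2 hR3 hg₀ hσf₀ hf₀]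
  simp only [Nat.add_sub_cancel]
  have hq : 1 < Nat.card 𝓀[K] := Finite.one_lt_card
  have hq1 : ((Nat.card 𝓀[K] : ℚ) - 1) ≠ 0 := sub_ne_zero.2 (by exact_mod_cast hq.ne')
  have hq0 : (Nat.card 𝓀[K] : ℚ) ≠ 0 := by exact_mod_cast (by omega : Nat.card 𝓀[K] ≠ 0)
  have hc0 : ((((Nat.card 𝓀[K] - 1) * Nat.card 𝓀[K] ^ ((ρ + 2 * t + 1 + 1) / 2 - 1)) * ((Nat.card 𝓀[K] - 1) * Nat.card 𝓀[K] ^ ((2 * ρ + 1 + 1) / 2 - 1)) : ℕ) : ℚ) ≠ 0 := by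
    push_cast [Nat.cast_sub hq.le]
    exact mul_ne_zero (mul_ne_zero hq1 (pow_ne_zero _ hq0)) (mul_ne_zero hq1 (pow_ne_zero _ hq0))
  -- exponent bookkeeping (parity split on `ρ` and `m`)
  have hexp : ((ρ + 2 * t + 1) / 2 - (2 * ρ + 2 * t + 1 - m + 1) / 2) + ((ρ + 2 * t) + (2 * ρ)) =
      (ρ + t + (m + 1) / 2 - 1 + ρ % 2) + (((ρ + 2 * t + 1 + 1) / 2 - 1) + ((2 * ρ + 1 + 1) / 2 - 1)) := by
    rcases Nat.even_or_odd ρ with ⟨a, ha⟩ | ⟨a, ha⟩ <;> rcases Nat.even_or_odd m with ⟨b, hb⟩ | ⟨b, hb⟩ <;> subst ha <;> subst hb <;> omega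
  have key : (Nat.card 𝓀[K] : ℚ) ^ ((ρ + 2 * t + 1) / 2 - (2 * ρ + 2 * t + 1 - m + 1) / 2) *
        ((Nat.card 𝓀[K] : ℚ) ^ (ρ + 2 * t) * (Nat.card 𝓀[K] : ℚ) ^ (2 * ρ)) =
      (Nat.card 𝓀[K] : ℚ) ^ (ρ + t + (m + 1) / 2 - 1 + ρ % 2) * ((Nat.card 𝓀[K] : ℚ) ^ ((ρ + 2 * t + 1 + 1) / 2 - 1) * (Nat.card 𝓀[K] : ℚ) ^ ((2 * ρ + 1 + 1) / 2 - 1)) := by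
    rw [← pow_add, ← pow_add, ← pow_add, ← pow_add, hexp]
  rw [mul_inv_eq_iff_eq_mul₀ hc0]
  push_cast [Nat.cast_sub hq.le]
  linear_combination ((Nat.card 𝓀[K] : ℚ) - 1) ^ 2 * key

/-- **TYPE 2 — NO GLUE BEYOND THE F-RATIONALITY DEPTH OF THE GLUE UNIT**: on the same foot, if NO fixed `f` has `|f + (β−1)∕(α−1)| ≤ |ϖ|^{2ρ+2t+1−m}`, the stable (R)-family is empty and
the sum is `0`. [cite: Kottwitz1986BaseChangeUnits, §1 pp. 240–241] -/
theorem finsum_stabiliserWeight_gluedR_foot_typeTwo_eq_zero {σ : K →+* K} (hσ : ∀ a, σ (σ a) = a) (hvσ : ∀ a, Valued.v (σ a) = Valued.v a)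
    (hfix : ∀ x : K, σ x = x → x ≠ 0 → ∃ n : ℤ, Valued.v x = exp (2 * n)) {ϖ : K} (hϖ : Valued.v ϖ = exp (-1 : ℤ))
    {d : ℕ} (hd : Valued.v (ϖ - σ ϖ) = Valued.v ϖ ^ d) [Finite 𝓀[K]]
    {α β : K} (hα : Valued.v α = 1) (hβ : Valued.v β = 1) (T : GL (Fin 3) K) (hT : (T : Matrix (Fin 3) (Fin 3) K) = Matrix.diagonal ![α, β, 1])
    (ρ t m : ℕ) (hρ : 1 ≤ ρ) (h₁ : Valued.v (β - 1) = Valued.v ϖ ^ (m + 2 * t)) (h₂ : Valued.v (α - 1) = Valued.v ϖ ^ m)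
    (h₃ : Valued.v (β - α) = Valued.v ϖ ^ m) (hρm : ρ + 1 ≤ m) (hm : m < 2 * ρ + 1)
    (hno : ¬ ∃ f : K, σ f = f ∧ Valued.v (f + (β - 1) / (α - 1)) ≤ Valued.v ϖ ^ (2 * ρ + 2 * t + 1 - m)) :
    ∑ᶠ M ∈ {M : Submodule 𝒪[K] (Fin 3 → K) | ∃ x ζ y'' : K, Valued.v x = 1 ∧ Valued.v ζ = 1 ∧ Valued.v y'' = Valued.v ϖ ^ (2 * t) ∧
        M = latt (!![1, 0, 0; x, ϖ ^ ρ, 0; x * ζ + y'', ϖ ^ ρ * ζ, ϖ ^ (2 * ρ + 2 * t + 1)] : Matrix (Fin 3) (Fin 3) K) ∧ mapGL T M = M ∧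
        ∃ f : K, σ f = f ∧ Valued.v (ζ * σ y'' - σ x * f) ≤ Valued.v ϖ ^ (ρ + 2 * t)},
        stabiliserWeight σ M = 0 := by
  obtain ⟨R, hRfin, -, hR1, hR2, hR3⟩ := exists_fixed_class_representatives hσ hvσ hfix hϖ hd ρ t hρ
  rw [finsum_stabiliserWeight_gluedR_foot_corner_eq_ncard_mul hσ hvσ hfix hϖ hd hα hβ T hT ρ t 1 m hρ h₁ h₂ h₃ hρm hm hRfin hR1 hR2 hR3,
    glue_representatives_eq_empty hR1 hno, Set.ncard_empty, Nat.cast_zero, zero_mul, zero_mul]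

end Summit.HodgeConjecture.HodgeConjecture.Cruxes.H413.F0P3cDyRamDiagonalGluedFootContributionCorner

end
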